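import Summits.BirchSwinnertonDyer.BirchSwinnertonDyer.Theorems.GenusKolyvaginAtTwoTorsionCellD0PairTwistSymbols
import HarnessLib

/-!
# D0≤2: reciprocity transport of the `S`-unit `e₂ − e₁` between the two admissible primes

Crux R″ `RankOneTwoTorsionResidualAtTwo` (stmt-27478), LINE 49 «full_vertex», stub D0≤2
`FullTorsionGenusSelmerLawUpToTwoAtTwo`, slice `#Q₀ = 2`. The `2`-descent for `C₁ = E₀^{(−p₀q₁q₂)}`
(`…D0TripleTwistBound`) uses ONE bit `t = qr_{q₁}(e₂ − e₁) = qr_{q₂}(e₂ − e₁)`: the two residue characters agree on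
the root difference because `e₂ − e₁` is (a quarter of) an integer all of whose prime factors lie in `S`, and
`qr_{q₁}(ℓ) = qr_{q₂}(ℓ)` for every `ℓ ∈ S` (the split condition `(q₁q₂/ℓ) = 1`, quadratic reciprocity) and for `ℓ = −1`.

* `qrBit_natCast_eq_of_forall_prime_dvd`, `qrBit_intCast_eq_of_forall_prime_dvd` — two residue characters agreeing
  on the prime factors of `n` (and on `−1`) agree on `n`;
* **`qrBit_sub_roots_eq_of_intCast`** — for a model with `4eᵢ ∈ ℤ` and `v_ℓ(e₁ − e₂) = 0` off `S ∋ 2`: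
  `qr_q(e₂ − e₁) = qr_{q'}(e₂ − e₁)` whenever `qr_q = qr_{q'}` on `−1` and on the primes of `S`.

Everything is proved; no LINE 49 statement is restated; BSD is not advanced by this file alone.

## References

* [SilvermanAEC2009] J. H. Silverman, *The Arithmetic of Elliptic Curves*, 2nd ed., GTM 106, Prop. X.1.4, X.4.9.
-/

noncomputable section

open scoped Classical

namespace Summit.BirchSwinnertonDyer.BirchSwinnertonDyer.Theorems.GenusKolyvaginAtTwo.TorsionCellD0

open WeierstrassCurve WeierstrassCurve.Affine WeierstrassCurve.Affine.Point
open Literature.NumberTheory.GaloisRepresentations Literature.NumberTheory.EllipticCurves Field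
open Literature.NumberTheory.EllipticCurves.TwoDescentLocal
open Literature.NumberTheory.EllipticCurves.KramerTwoDescent
open IsDedekindDomain NumberField Rat.HeightOneSpectrum

variable {q q' : ℕ} [hq : Fact q.Prime] [hq' : Fact q'.Prime]

/-- **Two residue characters agreeing on the prime factors of `n ≠ 0` agree on `n`** (multiplicativity of `qr`).
[folklore] -/
theorem qrBit_natCast_eq_of_forall_prime_dvd (n : ℕ) (hn : n ≠ 0)
    (hR : ∀ ℓ : ℕ, ℓ.Prime → ℓ ∣ n → qrBit q (ℓ : ℚ) = qrBit q' (ℓ : ℚ)) : qrBit q (n : ℚ) = qrBit q' (n : ℚ) := by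
  induction n using Nat.strong_induction_on with
  | _ n ih =>
    by_cases h1 : n = 1
    · subst h1; rw [Nat.cast_one, show (1 : ℚ) = 1 * 1 by norm_num, qrBit_mul_self, qrBit_mul_self]
    · have hℓ : n.minFac.Prime := Nat.minFac_prime h1
      obtain ⟨m, hm⟩ := Nat.minFac_dvd n
      have hm0 : m ≠ 0 := by rintro rfl; rw [mul_zero] at hm; exact hn hm
      have hℓ0 : (n.minFac : ℚ) ≠ 0 := by exact_mod_cast hℓ.ne_zero
      have hmq : (m : ℚ) ≠ 0 := by exact_mod_cast hm0
      have hmlt : m < n := by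
        rw [hm]; exact lt_mul_left (Nat.pos_of_ne_zero hm0) hℓ.one_lt
      have hdm : ∀ ℓ : ℕ, ℓ.Prime → ℓ ∣ m → qrBit q (ℓ : ℚ) = qrBit q' (ℓ : ℚ) :=
        fun ℓ hℓp hℓm => hR ℓ hℓp (hm ▸ Dvd.dvd.mul_left hℓm _)
      rw [hm, Nat.cast_mul, qrBit_mul q hℓ0 hmq, qrBit_mul q' hℓ0 hmq, hR _ hℓ (Nat.minFac_dvd n), ih m hmlt hm0 hdm]

/-- Integer version: agreement on `−1` and on the prime factors of `n ≠ 0` gives agreement on `n`. [folklore] -/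
theorem qrBit_intCast_eq_of_forall_prime_dvd (n : ℤ) (hn : n ≠ 0) (hm1 : qrBit q (-1 : ℚ) = qrBit q' (-1 : ℚ))
    (hR : ∀ ℓ : ℕ, ℓ.Prime → (ℓ : ℤ) ∣ n → qrBit q (ℓ : ℚ) = qrBit q' (ℓ : ℚ)) : qrBit q (n : ℚ) = qrBit q' (n : ℚ) := by
  have habs : (n : ℚ) = (n.sign : ℚ) * ((n.natAbs : ℕ) : ℚ) := by
    have := congrArg (Int.cast : ℤ → ℚ) (Int.sign_mul_natAbs n).symm
    rwa [Int.cast_mul, Int.cast_natCast] at this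
  have hn0 : (n.natAbs : ℕ) ≠ 0 := Int.natAbs_ne_zero.mpr hn
  have hnat := qrBit_natCast_eq_of_forall_prime_dvd (q := q) (q' := q') n.natAbs hn0
    (fun ℓ hℓ hℓn => hR ℓ hℓ (Int.natCast_dvd.mpr hℓn))
  have hs0' : n.sign ≠ 0 := fun h => hn (Int.sign_eq_zero_iff_zero.mp h)
  have hs0 : (n.sign : ℚ) ≠ 0 := by exact_mod_cast hs0'
  have hnq : ((n.natAbs : ℕ) : ℚ) ≠ 0 := by exact_mod_cast hn0
  rw [habs, qrBit_mul q hs0 hnq, qrBit_mul q' hs0 hnq, hnat]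
  rcases lt_or_gt_of_ne hn with hlt | hgt
  · rw [Int.sign_eq_neg_one_of_neg hlt, Int.cast_neg, Int.cast_one, hm1]
  · rw [Int.sign_eq_one_of_pos hgt, Int.cast_one, show (1 : ℚ) = 1 * 1 by norm_num, qrBit_mul_self, qrBit_mul_self]

/-- **Reciprocity transport of the root difference.** For a model with `4e₁, 4e₂ ∈ ℤ`, `e₁ ≠ e₂`, and
`v_ℓ(e₁ − e₂) = 0` for every prime `ℓ ∉ S` (`2 ∈ S`): if `qr_q(−1) = qr_{q'}(−1)` and `qr_q(ℓ) = qr_{q'}(ℓ)` for all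
`ℓ ∈ S`, then `qr_q(e₂ − e₁) = qr_{q'}(e₂ − e₁)`. [folklore] -/
theorem qrBit_sub_roots_eq_of_intCast {e₁ e₂ : ℚ} {n₁ n₂ : ℤ} (hn₁ : (n₁ : ℚ) = 4 * e₁) (hn₂ : (n₂ : ℚ) = 4 * e₂)
    (hne : e₁ ≠ e₂) (S : Finset ℕ) (h2S : 2 ∈ S)
    (hgood : ∀ ℓ : ℕ, (hℓ : ℓ.Prime) → ℓ ∉ S → haveI : Fact ℓ.Prime := ⟨hℓ⟩; padicValRat ℓ (e₁ - e₂) = 0)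
    (hm1 : qrBit q (-1 : ℚ) = qrBit q' (-1 : ℚ)) (hR1 : ∀ ℓ ∈ S, qrBit q (ℓ : ℚ) = qrBit q' (ℓ : ℚ)) :
    qrBit q (e₂ - e₁) = qrBit q' (e₂ - e₁) := by
  have hsub : e₂ - e₁ = ((n₂ - n₁ : ℤ) : ℚ) * ((1 / 2) * (1 / 2)) := by push_cast; rw [hn₁, hn₂]; ring
  have hN0 : (n₂ - n₁ : ℤ) ≠ 0 := by
    intro h0
    have : ((n₂ - n₁ : ℤ) : ℚ) = 0 := by rw [h0, Int.cast_zero]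
    push_cast at this; rw [hn₁, hn₂] at this
    exact hne (by linarith)
  have hNq : ((n₂ - n₁ : ℤ) : ℚ) ≠ 0 := by exact_mod_cast hN0
  have hR : ∀ ℓ : ℕ, ℓ.Prime → (ℓ : ℤ) ∣ (n₂ - n₁) → qrBit q (ℓ : ℚ) = qrBit q' (ℓ : ℚ) := by
    intro ℓ hℓ hdvd
    by_cases hℓS : ℓ ∈ S
    · exact hR1 ℓ hℓS
    · exfalso
      haveI : Fact ℓ.Prime := ⟨hℓ⟩
      have hℓ2 : ℓ ≠ 2 := fun h2 => hℓS (h2 ▸ h2S)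
      have hv := hgood ℓ hℓ hℓS
      have h4 : padicValRat ℓ (4 : ℚ) = 0 := by
        rw [show (4 : ℚ) = ((4 : ℕ) : ℚ) by norm_num, padicValRat.of_nat]
        have : padicValNat ℓ 4 = 0 := padicValNat.eq_zero_of_not_dvd fun hd =>
          hℓ2 ((Nat.prime_dvd_prime_iff_eq hℓ Nat.prime_two).mp (hℓ.dvd_of_dvd_pow (by simpa using hd : ℓ ∣ 2 ^ 2)))
        rw [this]; rfl
      have hnn0 : n₁ - n₂ ≠ 0 := by rw [show n₁ - n₂ = -(n₂ - n₁) by ring]; exact neg_ne_zero.mpr hN0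
      have hee : e₁ - e₂ = ((n₁ - n₂ : ℤ) : ℚ) / 4 := by push_cast; rw [hn₁, hn₂]; ring
      rw [hee, padicValRat.div (by exact_mod_cast hnn0) (by norm_num), h4, sub_zero, padicValRat.of_int] at hv
      have h0 : padicValInt ℓ (n₁ - n₂) = 0 := by exact_mod_cast hv
      rcases padicValInt.eq_zero_iff.mp h0 with h1 | h1 | h1
      · exact hℓ.ne_one h1
      · exact hnn0 h1
      · exact h1 ((dvd_sub_comm.mp hdvd))
  rw [hsub, qrBit_mul q hNq (by norm_num), qrBit_mul q' hNq (by norm_num), qrBit_mul_self, qrBit_mul_self,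
    qrBit_intCast_eq_of_forall_prime_dvd _ hN0 hm1 hR]

end Summit.BirchSwinnertonDyer.BirchSwinnertonDyer.Theorems.GenusKolyvaginAtTwo.TorsionCellD0

end
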